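import Mathlib
import Summits.MatrixMultiplication.MatrixMultiplication.Theorems.SnSubsetDichotomyPolynomialSlackCommonValueFibring
import Summits.MatrixMultiplication.MatrixMultiplication.Theorems.SnSubsetDichotomyPolynomialSlackCommonValueBumps

/-!
# Pair entry cap from fibring: every pair marginal is at most `√(3F/n)` of the pair set

Crux `Summit.MatrixMultiplication.MatrixMultiplication.Theses.SnSubsetDichotomy.PolynomialSlack`
(item `stmt-MatrixMultiplication-8306`), level-one programme, lead c5 (point branch). For a TPP triple
`S, T, U ⊆ S_n` the pair marginal `m_{ST}(i,j) = #{(s,t) : t j = s i}` is the sum over VALUES `v` of the product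
of the set marginals `c_S(i→v)·c_T(j→v)` (`pairMarginal_eq_sum_mul`); a large pair marginal therefore forces
two members to have point bumps at a COMMON value (`commonValueBumps`, Cauchy–Schwarz), and two such bumps
fibre into `Stab(v) ≅ S_{n-1}` at the lift rate `n` only (`commonValue_volume_le_explicit`, BCGPU one
dimension down). Combining:

* `pairMarginal_sq_mul_card_le` — `m_{ST}(i,j)² · |U| ≤ |S||T| · n · R_{n-1}`,
  `R_{n-1} = ((n-1)!)^{3/2}/√⌊(n-1)/4⌋ + (n-1)!`, for every TPP triple of `S_n`, `n ≥ 6`, all `i, j`.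

In normalised terms (`D_A(i,j) = m_{ST}(i,j)/(|S||T|)`, `N = |S||T||U| = (n!)^{3/2}/F`): `D_A(i,j)² ≤ n·R_{n-1}/N ≈ 3F/n`,
i.e. the spread parameter of every pair quotient obeys `λ ≤ √(3Fn)` — a new entry cap, sharper than the
injectivity cap `λ ≤ K` whenever `K² > 3Fn`, and with no parity, flatness or pinning hypothesis.
-/

namespace Summit.MatrixMultiplication.MatrixMultiplication.Theorems.PolynomialSlack

open scoped BigOperators
open Literature.Combinatorics.Additive (TripleProductProperty)

set_option linter.dupNamespace false

/-- **Pair entry cap from fibring.** For `n ≥ 6`, every TPP triple `(S, T, U)` of `S_n` and all positions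
`i, j`: `m_{ST}(i,j)² · |U| ≤ |S|·|T| · n · (((n-1)!)^{3/2}/√⌊(n-1)/4⌋ + (n-1)!)`, where
`m_{ST}(i,j) = #{(s,t) ∈ S × T : t j = s i}` (Cauchy–Schwarz `commonValueBumps` + fibring cap
`commonValue_volume_le_explicit`). [folklore] -/
theorem pairMarginal_sq_mul_card_le {n : ℕ} (hn : 6 ≤ n) {S T U : Finset (Equiv.Perm (Fin n))}
    (h : TripleProductProperty S T U) (i j : Fin n) :
    ((((S ×ˢ T).filter fun st => st.2 j = st.1 i).card : ℕ) : ℝ) ^ 2 * U.card ≤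
      ((S.card * T.card : ℕ) : ℝ) *
        (n * (((n - 1).factorial : ℝ) ^ (3 / 2 : ℝ) / Real.sqrt (((n - 1) / 4 : ℕ) : ℝ) +
          (n - 1).factorial)) := by
  obtain ⟨v, hv⟩ := commonValueBumps S T i j
  have hfib := commonValue_volume_le_explicit hn v h i j
  push_cast at hfib
  have hU : (0 : ℝ) ≤ U.card := Nat.cast_nonneg _
  have hST : (0 : ℝ) ≤ ((S.card * T.card : ℕ) : ℝ) := Nat.cast_nonneg _
  calc ((((S ×ˢ T).filter fun st => st.2 j = st.1 i).card : ℕ) : ℝ) ^ 2 * U.card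
      ≤ ((S.card * T.card : ℕ) : ℝ) *
          (((S.filter fun x => x i = v).card : ℝ) * ((T.filter fun y => y j = v).card : ℝ)) *
            U.card := mul_le_mul_of_nonneg_right hv hU
    _ = ((S.card * T.card : ℕ) : ℝ) *
          (((S.filter fun x => x i = v).card : ℝ) * ((T.filter fun y => y j = v).card : ℝ) *
            U.card) := by ring
    _ ≤ ((S.card * T.card : ℕ) : ℝ) *
          (n * (((n - 1).factorial : ℝ) ^ (3 / 2 : ℝ) / Real.sqrt (((n - 1) / 4 : ℕ) : ℝ) +
            (n - 1).factorial)) := mul_le_mul_of_nonneg_left hfib hST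

/-- **Pair entry cap, normalised.** In the situation of `pairMarginal_sq_mul_card_le`, if the triple is
non-degenerate (`|S||T||U| > 0`) then the pair density `D_A(i,j) = m_{ST}(i,j)/(|S||T|)` satisfies
`D_A(i,j)² ≤ n·R_{n-1}/(|S||T||U|)` with `R_{n-1} = ((n-1)!)^{3/2}/√⌊(n-1)/4⌋ + (n-1)!`. [folklore] -/
theorem pairDensity_sq_le {n : ℕ} (hn : 6 ≤ n) {S T U : Finset (Equiv.Perm (Fin n))}
    (h : TripleProductProperty S T U) (hN : 0 < S.card * T.card * U.card) (i j : Fin n) :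
    ((((S ×ˢ T).filter fun st => st.2 j = st.1 i).card : ℝ) / (S.card * T.card : ℕ)) ^ 2 ≤
      n * (((n - 1).factorial : ℝ) ^ (3 / 2 : ℝ) / Real.sqrt (((n - 1) / 4 : ℕ) : ℝ) +
          (n - 1).factorial) / ((S.card * T.card * U.card : ℕ) : ℝ) := by
  have hmain := pairMarginal_sq_mul_card_le hn h i j
  have hST0 : 0 < S.card * T.card := Nat.pos_of_mul_pos_right hN |> fun h' => by
    rcases Nat.eq_zero_or_pos (S.card * T.card) with h0 | h0
    · rw [h0, zero_mul] at hN; exact absurd hN (lt_irrefl 0)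
    · exact h0
  have hSTr : (0 : ℝ) < ((S.card * T.card : ℕ) : ℝ) := by exact_mod_cast hST0
  have hNr : (0 : ℝ) < ((S.card * T.card * U.card : ℕ) : ℝ) := by exact_mod_cast hN
  rw [div_pow, div_le_div_iff₀ (pow_pos hSTr 2) hNr]
  set m : ℝ := (((S ×ˢ T).filter fun st => st.2 j = st.1 i).card : ℝ)
  set R : ℝ := n * (((n - 1).factorial : ℝ) ^ (3 / 2 : ℝ) / Real.sqrt (((n - 1) / 4 : ℕ) : ℝ) +
    (n - 1).factorial)
  have e : ((S.card * T.card * U.card : ℕ) : ℝ) = ((S.card * T.card : ℕ) : ℝ) * U.card := by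
    push_cast; ring
  rw [e]
  calc m ^ 2 * (((S.card * T.card : ℕ) : ℝ) * U.card)
      = (m ^ 2 * U.card) * ((S.card * T.card : ℕ) : ℝ) := by ring
    _ ≤ (((S.card * T.card : ℕ) : ℝ) * R) * ((S.card * T.card : ℕ) : ℝ) :=
        mul_le_mul_of_nonneg_right hmain hSTr.le
    _ = R * ((S.card * T.card : ℕ) : ℝ) ^ 2 := by ring

end Summit.MatrixMultiplication.MatrixMultiplication.Theorems.PolynomialSlack
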